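import Summits.FinalStateConjecture.FinalStateConjecture.Theorems.SeamedChartsExhaust.Negative.ExactSchwarzschildModel

/-!
# The exact Schwarzschild model satisfies `HonestCore ∧ SEAMED ∧ HasExhaustiveCharts`
# (negative-side support for crux `stmt-FinalStateConjecture-13551`, route `StarvedNecks`; cycle 2, part 3/4)

For every parameter set `P` of `ExactSchwarzschildModel.lean`: `SchwModel.honestCore_decomp` — the
let-bound predicate `Hc` of `Theses/StarvedNecks.lean` (clauses (a)–(d) of `HonestCore`), inlined verbatim,
holds for `(ST P, O P, decomp P, R₀)`; `SchwModel.seamed_decomp` — the let-bound `Sm` (all twelve clauses of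
`SEAMED`), inlined verbatim, holds with the one-member radius family `R i = Rc`, given the order-zero
Kerr–Schild tail bound `‖g_M − η‖ ≤ 1/10` on `{r ≥ R₀}`; `SchwModel.hasExhaustiveCharts_decomp` — the
conclusion of the crux holds in the model (the honest exterior settles to itself: by the static flow every
exterior point below chart time `τ₁` reaches the certified slab, every point above it is certified late);
`SchwModel.O_eq_core` — for `r₀ = 2M` the region has the shape `J⁺(univ) ∩ I⁻(d.charted)` of the crux.
No named fact is introduced (the predicates are `let`s, verbatim copies of the route file's).

References: M. Dafermos, I. Rodnianski, *Lectures on black holes and linear waves*, arXiv:0811.0354, §5.1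
(Schwarzschild/Kerr in ingoing Kerr–Schild coordinates, `∇t*` timelike); R. P. Kerr, A. Schild (1965), §3;
B. O'Neill, *Semi-Riemannian geometry*, Academic Press 1983, Ch. 14, pp. 402–403; M. Dafermos,
G. Holzegel, I. Rodnianski, M. Taylor, arXiv:2104.08222, §1.
-/

noncomputable section

open TopologicalSpace Manifold Filter Topology Set Function
open scoped ContDiff Topology ENNReal Manifold

-- instance search through nested operator types `E4 →L E4 →L E4 →L ℝ` (as in the tree files)
set_option maxSynthPendingDepth 3

namespace Summit.FinalStateConjecture.FinalStateConjecture.Theorems.SeamedChartsExhaust.Negative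

open Literature.Geometry.Lorentzian LorentzianMetric

namespace SchwModel

variable (P : Params)

/-! ### The clause set `HonestCore ∧ Seamed`, exhaustion, and the `O`-shape in the model -/

/-- The model has one hole. [folklore] -/
theorem decomp_N : (decomp P).N = 1 := rfl
/-- The model has `τ₀ = 0`. [folklore] -/
theorem decomp_τ₀ : (decomp P).τ₀ = 0 := rfl
/-- The hole chart of the model. [folklore] -/
theorem decomp_chart (i : Fin (decomp P).N) : (decomp P).chart i = Ψ P := rfl
/-- The hole background of the model is Kerr `(M, 0)` with the trivial motion. [folklore] -/
theorem decomp_background (i : Fin (decomp P).N) :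
    (decomp P).background i = boostedKerrBackground 1 0 P.M 0 := rfl
/-- The flat domain of the model. [folklore] -/
theorem decomp_flatDomain : (decomp P).flatDomain = U P := rfl
/-- The flat chart of the model. [folklore] -/
theorem decomp_flatChart : (decomp P).flatChart = Φ P := rfl
/-- The excision profile of the model. [folklore] -/
theorem decomp_excision (i : Fin (decomp P).N) : (decomp P).excision i = ρ P := rfl

/-- The hole index type `Fin 1` of the model is a subsingleton. [folklore] -/
scoped instance subsingleton_fin_N : Subsingleton (Fin (decomp P).N) :=
  show Subsingleton (Fin 1) from inferInstance

/-- The hole index type `Fin 1` of the model is inhabited. [folklore] -/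
scoped instance inhabited_fin_N : Inhabited (Fin (decomp P).N) := show Inhabited (Fin 1) from inferInstance

/-- The hole time of the trivial motion is `x⁰`. [folklore] -/
@[simp] theorem bg_time (x : E4) : (boostedKerrBackground 1 0 P.M 0).time x = x 0 := by
  show poincareInv 1 0 x 0 = x 0
  rw [poincareInv_one_zero]

/-- The hole radius of the trivial motion is the Kerr–Schild radius. [folklore] -/
@[simp] theorem bg_radius (x : E4) :
    (boostedKerrBackground 1 0 P.M 0).radius x = Kerr.radius 0 x := by
  show Kerr.radius 0 (poincareInv 1 0 x) = _
  rw [poincareInv_one_zero]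

/-- The trivial motion fixes `∂₀`. [folklore] -/
theorem motion_e0 : (((1 : lorentzGroup) : E4 ≃L[ℝ] E4) (E4.basisVector 0)) = E4.basisVector 0 := rfl

/-- The flat chart is the inclusion `U ↪ {r > r₀}`. [folklore] -/
theorem Φ_eq : Φ P = Opens.inclusion (hUreg P) := rfl

/-- A hole-domain point is in the exterior. -/
theorem Ψ_mem_O (x : (boostedKerrBackground 1 0 P.M 0).domain) : Ψ P x ∈ O P :=
  (mem_bext_iff P).mp x.2

/-- Flat-charted points are exterior points. [folklore] -/
theorem Φ_mem_O (y : (Minkowski.backgroundOn (U P)).domain) : Φ P y ∈ O P :=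
  (two_M_lt_ρ P (y.1 0)).trans y.2.2

/-- **`HonestCore` holds in the model** (the let-bound `Hc` of `Theses/StarvedNecks.lean`, verbatim):
(a) `|0| < M`, `100M ≤ R₀`, `(1 e₀)⁰ = 1 > 0`; (b) anchoring and the covering of deep hole-late points by
the static flow `∂₀`; (c) late tube images are `{τ' ≤ x⁰, 2M < r ≤ ϱ(x⁰)}`, whose closure in the patch adds
only horizon points, which are not in `O`; (d) `dΦ(e₀) = e₀` is future timelike on `{r > 2M}`.
Dafermos–Rodnianski arXiv:0811.0354, §5.1. [folklore] -/
theorem honestCore_decomp :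
    let Hc := ( fun (𝓢 : Spacetime.{0} 4) (O : Set 𝓢.carrier) (k : ℕ) (d : FinalStateDecomposition 𝓢 O k) (R₀ : ℝ) => let B := d.background; let t := fun i ↦ (B i).time; let r := fun i ↦ (B i).radius; let Ψ := d.chart; (∀ i, Kerr.IsSubextremal (d.mass i) (d.spin i) ∧ 100 * d.mass i ≤ R₀ ∧ 0 < ((d.motion i).1 : E4 ≃L[ℝ] E4) (E4.basisVector 0) 0) ∧ (∀ i (ϱ τ₂ : ℝ), R₀ ≤ ϱ → d.τ₀ < τ₂ → Ψ i '' {x | d.τ₀ < t i x.1 ∧ t i x.1 < τ₂ ∧ r i x.1 < ϱ} ⊆ 𝓢.metric.causalPast 𝓢.timeOrientation (Ψ i '' (B i).truncTimeSlab ϱ τ₂)) ∧ (∀ i (τ' : ℝ) (ϱ : ℝ → ℝ), Continuous ϱ → d.τ₀ < τ' → let A := Ψ i '' {x | τ' ≤ t i x.1 ∧ r i x.1 ≤ ϱ (t i x.1)}; closure A ∩ O ⊆ A) ∧ (∀ y : d.flatDomain, d.τ₀ < y.1 0 → 𝓢.timeOrientation.IsFutureDirected (mfderiv 𝓘(ℝ,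 E4) (𝓡 4) d.flatChart y (E4.basisVector 0))) )
    Hc (ST P) (O P) 2 (decomp P) P.R₀ := by
  intro Hc
  refine ⟨fun i ↦ ⟨?_, P.hR₀, ?_⟩, ?_, ?_, ?_⟩
  · -- (a) sub-extremal
    show |(0 : ℝ)| < P.M
    rw [abs_zero]; exact P.hM
  · -- (a) orthochronous
    show (0 : ℝ) < (((1 : lorentzGroup) : E4 ≃L[ℝ] E4) (E4.basisVector 0)) 0
    rw [motion_e0]
    simp
  · -- (b) anchoring by the static flow
    rintro i ϱ τ₂ - - _ ⟨x, ⟨-, hxτ, hxr⟩, rfl⟩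
    simp only [decomp_background, bg_time, bg_radius] at hxτ hxr
    set s : ℝ := τ₂ - x.1 0 with hs
    have hs0 : 0 ≤ s := by linarith
    have hqO : up P (Ψ P x) s ∈ O P := by rw [mem_O, radius_up]; exact Ψ_mem_O P x
    refine causalFuture_mono (singleton_subset_iff.mpr ?_) (mem_causalPast_up P _ (Ψ_mem_O P x) hs0)
    obtain ⟨hq', hqeq⟩ := eq_Ψ P (up P (Ψ P x) s) hqO
    refine ⟨⟨(up P (Ψ P x) s).1, hq'⟩, ⟨?_, ?_⟩, hqeq⟩
    · show poincareInv 1 0 (up P (Ψ P x) s).1 0 = τ₂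
      rw [poincareInv_one_zero, up_zero_apply, Ψ_val, hs]; ring
    · show Kerr.radius 0 (poincareInv 1 0 (up P (Ψ P x) s).1) ≤ ϱ
      rw [poincareInv_one_zero, radius_up, Ψ_val]; exact hxr.le
  · -- (c) relative closedness in `O`
    intro i τ' ϱ hϱ _ _ z hz
    obtain ⟨hzc, hzO⟩ := hz
    set C : Set E4 := {w | τ' ≤ w 0 ∧ Kerr.radius 0 w ≤ ϱ (w 0)} with hC
    have hCc : IsClosed C :=
      (isClosed_le continuous_const (PiLp.continuous_apply 2 _ 0)).inter
        (isClosed_le (Kerr.continuous_radius 0) (hϱ.comp (PiLp.continuous_apply 2 _ 0)))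
    have hsub : (decomp P).chart i '' {x | τ' ≤ ((decomp P).background i).time x.1 ∧
        ((decomp P).background i).radius x.1 ≤ ϱ (((decomp P).background i).time x.1)} ⊆
        Subtype.val ⁻¹' C := by
      rintro _ ⟨x, ⟨h1, h2⟩, rfl⟩
      simp only [decomp_background, bg_time, bg_radius] at h1 h2
      exact ⟨h1, h2⟩
    have hz1 : z.1 ∈ C := closure_minimal hsub (hCc.preimage continuous_subtype_val) hzc
    obtain ⟨hzt, hzr⟩ := hz1
    obtain ⟨hz', hzeq⟩ := eq_Ψ P z hzO
    refine ⟨⟨z.1, hz'⟩, ?_, hzeq⟩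
    show τ' ≤ (boostedKerrBackground 1 0 P.M 0).time z.1 ∧
      (boostedKerrBackground 1 0 P.M 0).radius z.1 ≤ ϱ ((boostedKerrBackground 1 0 P.M 0).time z.1)
    rw [bg_time, bg_radius]
    exact ⟨hzt, hzr⟩
  · -- (d) the flat chart is future oriented
    intro y _
    have hrad : 2 * P.M < Kerr.radius 0 (Φ P y).1 := Φ_mem_O P y
    exact (congrArg (fun w : E4 ↦ (ST P).timeOrientation.IsFutureDirected (x := Φ P y) w)
      (OpensChart.mfderiv_inclusion_apply (hUreg P) y (E4.basisVector 0))).mpr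
        (Schw.isFutureDirected_e0 (hM := P.hM.le) (Φ P y) hrad)

/-- **`SEAMED` holds in the model** (the let-bound `Sm` of `Theses/StarvedNecks.lean`, verbatim, all
twelve conjuncts) with the one-member family `R i = Rc = R₀ + 4 + √·`, given the order-zero Kerr–Schild
tail bound `‖g_M − η‖ ≤ 1/10` on `{r ≥ R₀}` (available for `R₀` large, `exists_tail_tenth`): both
deviations of the identity hole chart vanish identically, the flat deviation is the Kerr–Schild term, one
atlas/clock lag/far leaves are identities, tube walls are hole-charted. Kerr–Schild 1965, §3. [folklore] -/
theorem seamed_decomp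
    (htail : ∀ x : E4, P.R₀ ≤ Kerr.radius 0 x → ‖Kerr.bilin P.M 0 x - Minkowski.bilin‖ ≤ 10⁻¹) :
    let Sm := ( fun (𝓢 : Spacetime.{0} 4) (O : Set 𝓢.carrier) (d : FinalStateDecomposition 𝓢 O 2) (R : Fin d.N → ℝ → ℝ) (R₀ : ℝ) => let B := d.background; let t := fun i ↦ (B i).time; let r := fun i ↦ (B i).radius; let Λ := fun i ↦ ((d.motion i).1 : E4 ≃L[ℝ] E4); let Φ := d.flatChart; let Ψ := d.chart; let ρ := d.excision; (∀ i, Monotone (R i) ∧ Continuous (R i) ∧ ∀ s, R₀ + 4 ≤ R i s ∧ R₀ ≤ ρ i s) ∧ (∀ i, Tendsto (fun τ ↦ 𝓢.truncDeviationCk (B i) (Ψ i) 2 (R i τ) τ) atTop (𝓝 0)) ∧ supCkENorm (Subtype.val '' {y : d.flatDomain | d.τ₀ ≤ y.1 0}) 0 (𝓢.deviationExtend (Minkowski.backgroundOn d.flatDomain) Φ) ≤ 10⁻¹ ∧ (∀ i, supCkENorm (Subtype.val '' {x : (B i).domain | (d.τ₀ ≤ t i x.1 ∨ d.τ₀ ≤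 x.1 0) ∧ R₀ ≤ r i x.1 ∧ r i x.1 ≤ R i (t i x.1)}) 0 (𝓢.deviationExtend (B i) (Ψ i)) ≤ ENNReal.ofReal (1 / (10 * ‖(Λ i : E4 →L[ℝ] E4)‖ ^ 2))) ∧ (∀ i (x : (B i).domain), (d.τ₀ ≤ t i x.1 ∨ d.τ₀ ≤ x.1 0) → R₀ ≤ r i x.1 → r i x.1 ≤ R i (t i x.1) → 𝓢.timeOrientation.IsFutureDirected (mfderiv 𝓘(ℝ, E4) (𝓡 4) (Ψ i) x ((Λ i) (E4.basisVector 0)))) ∧ (∀ i (y : E4) (hy : y ∈ (B i).domain), d.τ₀ ≤ y 0 → (∀ j, ρ j (y 0) < r j y) → r i y ≤ R i (t i y) + 1 → ∃ hy' : y ∈ d.flatDomain, Ψ i ⟨y, hy⟩ = Φ ⟨y, hy'⟩) ∧ (∀ y : d.flatDomain, d.τ₀ ≤ y.1 0 → ∀ j, ρ j (y.1 0) < r j y.1) ∧ (∀ j (y : E4), d.τ₀ ≤ y 0 → r j y ≤ ρ j (y 0) → r j y + 2 ≤ R j (t j y)) ∧ (∀ j (y : E4), d.τ₀ ≤ t j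 y → r j y ≤ R j (t j y) + 2 → t j y ≤ y 0) ∧ (∀ j, Ψ j '' {x | d.τ₀ < t j x.1 ∧ R j (t j x.1) + 1 < r j x.1} ⊆ d.radiationZone) ∧ (∀ τ' : ℝ, d.τ₀ < τ' → closure (Φ '' {y | τ' ≤ y.1 0}) ⊆ Φ '' {y | τ' ≤ y.1 0} ∪ ⋃ j, Ψ j '' {x | τ' ≤ x.1 0 ∧ r j x.1 = ρ j (x.1 0)}) ∧ (∀ j j' (y : E4), j ≠ j' → (d.τ₀ ≤ y 0 ∨ d.τ₀ ≤ t j y) → r j y ≤ R j (t j y) + 1 → R j' (t j' y) + 1 < r j' y) )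
    Sm (ST P) (O P) (decomp P) (fun _ ↦ Rc P) P.R₀ := by
  intro Sm
  refine ⟨fun i ↦ ⟨monotone_Rc P, continuous_Rc P, fun s ↦ ⟨?_, ?_⟩⟩, ?_, ?_, ?_, ?_, ?_, ?_, ?_, ?_,
    ?_, ?_, ?_⟩
  · show P.R₀ + 4 ≤ Rc P s
    unfold Rc; linarith [Real.sqrt_nonneg s]
  · show P.R₀ ≤ ρ P s
    linarith [ρ_ge P s]
  · -- (2) certification to radius `Rc`: the deviation vanishes identically
    intro i
    show Tendsto (fun τ ↦ (ST P).truncDeviationCk (boostedKerrBackground 1 0 P.M 0) (Ψ P) 2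
      (Rc P τ) τ) atTop (𝓝 0)
    simp_rw [truncDeviationCk_Ψ]
    exact tendsto_const_nhds
  · -- (3) flat `C⁰` threshold: the Kerr–Schild tail beyond `R₀`
    show supCkENorm (Subtype.val '' {y : (U P) | (0 : ℝ) ≤ y.1 0}) 0
      ((ST P).deviationExtend (Minkowski.backgroundOn (U P)) (ΨK P ∘ Opens.inclusion (hUext P))) ≤ 10⁻¹
    refine iSup₂_le fun m hm ↦ iSup₂_le fun z hz ↦ ?_
    obtain ⟨y, -, rfl⟩ := hz
    have hm0 : m = 0 := Nat.le_zero.mp hm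
    subst hm0
    rw [← ofReal_norm, norm_iteratedFDeriv_zero,
      (ST P).deviationExtend_backgroundOn_comp_inclusion (hUext P) (isLateChart_ΨK P).contMDiff y.2,
      deviationExtend_ΨK, Pi.zero_apply, zero_add]
    have hr : P.R₀ ≤ Kerr.radius 0 y.1 := by linarith [ρ_ge P (y.1 0), y.2.2]
    calc ENNReal.ofReal ‖Kerr.bilin P.M 0 y.1 - Minkowski.bilin‖
        ≤ ENNReal.ofReal (10⁻¹ : ℝ) := ENNReal.ofReal_le_ofReal (htail y.1 hr)
      _ = 10⁻¹ := by rw [ENNReal.ofReal_inv_of_pos (by norm_num), ENNReal.ofReal_ofNat]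
  · -- (4) hole `C⁰` threshold: the deviation vanishes identically
    intro i
    show supCkENorm _ 0 ((ST P).deviationExtend (boostedKerrBackground 1 0 P.M 0) (Ψ P)) ≤ _
    rw [deviationExtend_Ψ, supCkENorm_zero]
    exact bot_le
  · -- (5) hole time-lines `Λ e₀ = e₀` are future directed on `r ≥ R₀ > 2M`
    intro i x _ hR₀ _
    simp only [decomp_background, bg_radius] at hR₀
    have hrad : 2 * P.M < Kerr.radius 0 (Ψ P x).1 := by
      rw [Ψ_val]; linarith [P.two_M_lt_R₀]
    show (ST P).timeOrientation.IsFutureDirected (x := Ψ P x)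
      (mfderiv 𝓘(ℝ, E4) (𝓡 4) (Ψ P) x ((((1 : lorentzGroup) : E4 ≃L[ℝ] E4) (E4.basisVector 0))))
    rw [motion_e0]
    exact (congrArg (fun w : E4 ↦ (ST P).timeOrientation.IsFutureDirected (x := Ψ P x) w)
      (OpensChart.mfderiv_inclusion_apply (hbext P) x (E4.basisVector 0))).mpr
        (Schw.isFutureDirected_e0 (hM := P.hM.le) (Ψ P x) hrad)
  · -- (6) ONE ATLAS: both charts are the identity
    intro i y hy hy0 hρ _
    change (0 : ℝ) ≤ y 0 at hy0
    have h := hρ i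
    simp only [decomp_excision, decomp_background, bg_radius] at h
    exact ⟨⟨by linarith, h⟩, Subtype.ext rfl⟩
  · -- (7) flat-late domain points lie outside the flat tubes
    intro y _ j
    show ρ P (y.1 0) < (boostedKerrBackground 1 0 P.M 0).radius y.1
    rw [bg_radius]
    exact y.2.2
  · -- (8) flat tubes deep inside certified tubes: `ρ + 2 ≤ Rc = ρ + 3`
    intro j y _ hr
    show (boostedKerrBackground 1 0 P.M 0).radius y + 2 ≤ Rc P ((boostedKerrBackground 1 0 P.M 0).time y)
    change (boostedKerrBackground 1 0 P.M 0).radius y ≤ ρ P (y 0) at hr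
    rw [bg_time, Rc_eq]
    linarith
  · -- (9) clock lag: hole time = flat time
    intro j y _ _
    show (boostedKerrBackground 1 0 P.M 0).time y ≤ y 0
    rw [bg_time]
  · -- (10) far hole leaves are flat-late points
    rintro j _ ⟨x, ⟨hx0, hxr⟩, rfl⟩
    simp only [decomp_background, bg_time, bg_radius] at hx0 hxr
    change (0 : ℝ) < x.1 0 at hx0
    have hxU : x.1 ∈ U P := ⟨by linarith, by rw [Rc_eq] at hxr; linarith⟩
    exact ⟨⟨x.1, hxU⟩, hx0, Subtype.ext rfl⟩
  · -- (11) closures of closed flat-late slabs: flat points and hole-charted tube walls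
    intro τ' hτ' z hz
    change (0 : ℝ) < τ' at hτ'
    set C : Set E4 := {w | τ' ≤ w 0 ∧ ρ P (w 0) ≤ Kerr.radius 0 w} with hC
    have hCc : IsClosed C :=
      (isClosed_le continuous_const (PiLp.continuous_apply 2 _ 0)).inter
        (isClosed_le ((continuous_ρ P).comp (PiLp.continuous_apply 2 _ 0)) (Kerr.continuous_radius 0))
    have hsub : (decomp P).flatChart '' {y | τ' ≤ y.1 0} ⊆ Subtype.val ⁻¹' C := by
      rintro _ ⟨y, hy, rfl⟩
      exact ⟨hy, y.2.2.le⟩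
    have hz1 : z.1 ∈ C := closure_minimal hsub (hCc.preimage continuous_subtype_val) hz
    obtain ⟨hzt, hzr⟩ := hz1
    rcases hzr.lt_or_eq with hlt | heq
    · left
      have hzU : z.1 ∈ U P := ⟨by linarith, hlt⟩
      exact ⟨⟨z.1, hzU⟩, hzt, Subtype.ext rfl⟩
    · right
      refine mem_iUnion.mpr ⟨default, ?_⟩
      have hzO : z ∈ O P := by rw [mem_O, ← heq]; exact two_M_lt_ρ P _
      obtain ⟨hz', hzeq⟩ := eq_Ψ P z hzO
      refine ⟨⟨z.1, hz'⟩, ⟨hzt, ?_⟩, hzeq⟩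
      show (boostedKerrBackground 1 0 P.M 0).radius z.1 = ρ P (z.1 0)
      rw [bg_radius, heq]
  · -- (12) one hole: vacuous
    intro j j' _ hjj'
    exact absurd (Subsingleton.elim j j') hjj'

/-- Exhaustion holds in the model (the honest Schwarzschild exterior settles to itself): by the
static flow every exterior point below chart time `τ₁` reaches the certified slab, and every point
above it is certified late. -/
theorem hasExhaustiveCharts_decomp : HasExhaustiveCharts (decomp P) := by
  refine ⟨fun _ ↦ Rc P, fun i ↦ ⟨?_, fun τ ↦ ?_⟩, fun i ↦ ?_, fun τ₁ hτ₁ p hp ↦ ?_⟩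
  · -- honest radii (audit 2026-08-16 (B)): `Rc = R₀ + 4 + √· → ∞`
    show Tendsto (fun s ↦ P.R₀ + 4 + √s) atTop atTop
    exact tendsto_atTop_add_const_left _ _ Real.tendsto_sqrt_atTop
  · -- honest radii: `max (r₊(M, 0)) 0 + 1 = 2M + 1 ≤ R₀ + 4 + √τ`
    show max (Kerr.rPlus P.M 0) 0 + 1 ≤ Rc P τ
    rw [P.rPlus_eq, max_eq_left P.two_M_pos.le, Rc_eq]
    linarith [two_M_lt_ρ P τ]
  · show Tendsto (fun τ ↦ (ST P).truncDeviationCk (boostedKerrBackground 1 0 P.M 0) (Ψ P) 2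
      (Rc P τ) τ) atTop (𝓝 0)
    simp_rw [truncDeviationCk_Ψ]
    exact tendsto_const_nhds
  change (0 : ℝ) < τ₁ at hτ₁
  obtain ⟨hpO, hpF⟩ := hp
  rcases le_or_gt (p.1 0) τ₁ with hle | hgt
  · -- flow up to chart time `τ₁`
    set s : ℝ := τ₁ - p.1 0 with hs
    have hs0 : 0 ≤ s := by linarith
    have hqO : up P p s ∈ O P := by rw [mem_O, radius_up]; exact hpO
    have hq0 : (up P p s).1 0 = τ₁ := by rw [up_zero_apply, hs]; ring
    refine causalFuture_mono (singleton_subset_iff.mpr ?_) (mem_causalPast_up P p hpO hs0)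
    by_cases hr : ρ P τ₁ < Kerr.radius 0 p.1
    · -- on the flat slab
      left
      have hqU : (up P p s).1 ∈ U P := ⟨by rw [hq0]; linarith, by rw [hq0, radius_up]; exact hr⟩
      exact ⟨⟨(up P p s).1, hqU⟩, hq0, Subtype.ext rfl⟩
    · -- on the hole disc
      right
      refine mem_iUnion.mpr ⟨default, ?_⟩
      obtain ⟨hq', hqeq⟩ := eq_Ψ P (up P p s) hqO
      refine ⟨⟨(up P p s).1, hq'⟩, ⟨?_, ?_⟩, hqeq⟩
      · show (boostedKerrBackground 1 0 P.M 0).time (up P p s).1 = τ₁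
        rw [bg_time, hq0]
      · show (boostedKerrBackground 1 0 P.M 0).radius (up P p s).1 ≤ Rc P τ₁
        rw [bg_radius, radius_up, Rc_eq]
        linarith [not_lt.mp hr]
  · -- above `τ₁` every exterior point is certified late
    exfalso
    apply hpF
    by_cases hr : ρ P (p.1 0) < Kerr.radius 0 p.1
    · left
      have hpU : p.1 ∈ U P := ⟨by linarith, hr⟩
      exact ⟨⟨p.1, hpU⟩, hgt, Subtype.ext rfl⟩
    · right
      refine mem_iUnion.mpr ⟨default, ?_⟩
      obtain ⟨hp', hpeq⟩ := eq_Ψ P p hpO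
      refine ⟨⟨p.1, hp'⟩, ⟨?_, ?_⟩, hpeq⟩
      · show τ₁ < (boostedKerrBackground 1 0 P.M 0).time p.1
        rw [bg_time]; exact hgt
      · show (boostedKerrBackground 1 0 P.M 0).radius p.1 ≤
          Rc P ((boostedKerrBackground 1 0 P.M 0).time p.1)
        rw [bg_radius, bg_time, Rc_eq]
        linarith [not_lt.mp hr]

/-- Every exterior point lies in the chronological past of the charted (late) region: flow up along
`∂₀` past chart time `0`. -/
theorem mem_chronologicalPast_charted (x : (ST P).carrier) (hx : x ∈ O P) :
    x ∈ (ST P).metric.chronologicalPast (ST P).timeOrientation (decomp P).charted := by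
  set s : ℝ := |x.1 0| + 1 with hs
  have hs0 : 0 < s := by positivity
  have hqO : up P x s ∈ O P := by rw [mem_O, radius_up]; exact hx
  have hq : up P x s ∈ (decomp P).charted := by
    refine FinalStateDecomposition.region_subset_charted _ default ?_
    obtain ⟨hq', hqeq⟩ := eq_Ψ P (up P x s) hqO
    refine ⟨⟨(up P x s).1, hq'⟩, ?_, hqeq⟩
    show (0 : ℝ) < (boostedKerrBackground 1 0 P.M 0).time (up P x s).1
    rw [bg_time, up_zero_apply, hs]
    linarith [neg_abs_le (x.1 0)]
  have h1 := mem_chronologicalPast_of_mem_chronologicalFuture (up_mem_chronologicalFuture P x hx hs0)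
  exact chronologicalFuture_mono (singleton_subset_iff.mpr hq) h1

/-- For `r₀ = 2M` (the exterior patch) the region is everything ... -/
theorem O_eq_univ (h : P.r₀ = 2 * P.M) : O P = univ := by
  refine eq_univ_of_forall fun x ↦ ?_
  have hx := Kerr.lt_radius_of_mem_region x.2
  show 2 * P.M < Kerr.radius 0 x.1
  linarith

/-- ... and it has the shape `J⁺(Σ) ∩ I⁻(charted)` of the crux (`Σ = univ`). -/
theorem O_eq_core (h : P.r₀ = 2 * P.M) :
    O P = (ST P).metric.causalFuture (ST P).timeOrientation univ ∩
      (ST P).metric.chronologicalPast (ST P).timeOrientation (decomp P).charted := by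
  refine Subset.antisymm (fun x hx ↦ ⟨subset_causalFuture _ _ _ (mem_univ x),
    mem_chronologicalPast_charted P x hx⟩) fun x _ ↦ ?_
  rw [O_eq_univ P h]; exact mem_univ x

end SchwModel

end Summit.FinalStateConjecture.FinalStateConjecture.Theorems.SeamedChartsExhaust.Negative

end
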